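import Summits.Ventures.PercRepro.RankDistShadow

/-!
# PercRepro — the cumulative forms: C-025 from a binomial growth of the rank levels or of the shadow (p9, gen 17)

The chains of `RankDistWeighted` / `RankDistShadow` prove C-025 from ONE-STEP inequalities; what C-025 needs is only
the CUMULATIVE growth from level `q` to each level `q < u < p`:
* `rls_of_cumulative` — `c_q·C(p+q, u) ≤ c_u·C(p+q, q)` for every `q < u < p` gives `ThmN.RLS M p q`
  (`#U ≤ c_q`, `#Y = Σ c_u`);
* `ShadowCumulative M p q` and **`rls_of_shadowCumulative`** — the same on the upper shadow `∂_u 𝓑` of the bottom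
  sets (`shadowLev M u (PerFlat.Uq M p q)`, `s_u := #∂_u 𝓑`): `s_q·C(p+q, u) ≤ s_u·C(p+q, q)` for every `q < u < p`
  gives `ThmN.RLS M p q` (`#U ≤ #𝓑 ≤ s_q`, `s_u ≤ c_u`).
`ShadowCumulative M p q` is STRONGER than the level-wise form of C-025 at `(p, q)` (it starts from `s_q ≥ #𝓑` and ends at
`s_u ≤ c_u`); it is the statement this lane records as an OBSERVATION — it held on every pair of every census run
(random GF(2)/GF(3)/GF(5) matroids on `≤ 10` elements, 43,652 pairs; random simple blocks plus generic points, 2,827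
pairs; the K-block families at `(9, 7)`), with equality exactly on the tight layer `|E| = p + q` — typed here so that
it can be attacked or refuted in the tree's vocabulary. `shadowCumulative_of_step` shows the one-step shadow
inequalities at the levels `q … p − 2` imply it. Nothing here is a statement about any window of the crux.
-/

namespace PercRepro.RankDist

open Set Finset Matroid PercRepro.ThmH

variable {α : Type}

/-- **C-025 FROM THE CUMULATIVE GROWTH OF THE RANK LEVELS**: if `c_q·C(p+q, u) ≤ c_u·C(p+q, q)` for every
`q < u < p`, then `ThmN.RLS M p q`. -/
theorem rls_of_cumulative (M : Matroid α) [M.Finite] (p q : ℕ)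
    (hcum : ∀ u, q < u → u < p → levelCount M q * (p + q).choose u ≤ levelCount M u * (p + q).choose q) :
    ThmN.RLS M p q := by
  unfold ThmN.RLS phiK
  have hU := ncard_U_le_levelCount M p q
  rw [ncard_Y_eq_sum M p q]
  have hpos : (0 : ℚ) < ((p + q).choose p : ℚ) := by
    exact_mod_cast Nat.choose_pos (by omega)
  rw [div_mul_eq_mul_div, div_le_iff₀ hpos]
  have key : (∑ u ∈ Ioo q p, (p + q).choose u)
      * {A : Set α | A ⊆ M.E ∧ M.eRk A = (p : ℕ∞) ∧ M.eRk (M.E \ A) = (q : ℕ∞)}.ncard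
      ≤ (∑ u ∈ Ioo q p, levelCount M u) * (p + q).choose p := by
    calc (∑ u ∈ Ioo q p, (p + q).choose u)
          * {A : Set α | A ⊆ M.E ∧ M.eRk A = (p : ℕ∞) ∧ M.eRk (M.E \ A) = (q : ℕ∞)}.ncard
        ≤ (∑ u ∈ Ioo q p, (p + q).choose u) * levelCount M q := Nat.mul_le_mul_left _ hU
      _ = ∑ u ∈ Ioo q p, levelCount M q * (p + q).choose u := by
          rw [Finset.sum_mul]; exact Finset.sum_congr rfl fun u _ => mul_comm _ _
      _ ≤ ∑ u ∈ Ioo q p, levelCount M u * (p + q).choose q := by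
          refine Finset.sum_le_sum fun u hu => ?_
          rw [Finset.mem_Ioo] at hu
          exact hcum u hu.1 hu.2
      _ = (∑ u ∈ Ioo q p, levelCount M u) * (p + q).choose p := by
          rw [Finset.sum_mul, Nat.choose_symm_add]
  exact_mod_cast key

variable [DecidableEq α] (M : Matroid α) [M.Finite]

/-- **The cumulative shadow inequality at `(p, q)`**: the upper shadow of the bottom sets grows at least binomially
from its own level-`q` size — `#∂_q 𝓑·C(p+q, u) ≤ #∂_u 𝓑·C(p+q, q)` for every `q < u < p`. An observation of this
lane (0 violations on every census), typed as a statement; it implies `ThmN.RLS M p q`. -/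
def ShadowCumulative (p q : ℕ) : Prop :=
  ∀ u, q < u → u < p →
    (shadowLev M q (PerFlat.Uq M p q)).card * (p + q).choose u
      ≤ (shadowLev M u (PerFlat.Uq M p q)).card * (p + q).choose q

/-- **C-025 FROM THE CUMULATIVE SHADOW INEQUALITY**. -/
theorem rls_of_shadowCumulative (p q : ℕ) (hcum : ShadowCumulative M p q) : ThmN.RLS M p q := by
  unfold ThmN.RLS phiK
  have hU := PerFlat.ncard_U_le_card_Uq M p q
  rw [ncard_Y_eq_sum M p q]
  have hpos : (0 : ℚ) < ((p + q).choose p : ℚ) := by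
    exact_mod_cast Nat.choose_pos (by omega)
  rw [div_mul_eq_mul_div, div_le_iff₀ hpos]
  have key : (∑ u ∈ Ioo q p, (p + q).choose u)
      * {A : Set α | A ⊆ M.E ∧ M.eRk A = (p : ℕ∞) ∧ M.eRk (M.E \ A) = (q : ℕ∞)}.ncard
      ≤ (∑ u ∈ Ioo q p, levelCount M u) * (p + q).choose p := by
    calc (∑ u ∈ Ioo q p, (p + q).choose u)
          * {A : Set α | A ⊆ M.E ∧ M.eRk A = (p : ℕ∞) ∧ M.eRk (M.E \ A) = (q : ℕ∞)}.ncard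
        ≤ (∑ u ∈ Ioo q p, (p + q).choose u) * (PerFlat.Uq M p q).card := Nat.mul_le_mul_left _ hU
      _ = ∑ u ∈ Ioo q p, (PerFlat.Uq M p q).card * (p + q).choose u := by
          rw [Finset.sum_mul]; exact Finset.sum_congr rfl fun u _ => mul_comm _ _
      _ ≤ ∑ u ∈ Ioo q p, (shadowLev M u (PerFlat.Uq M p q)).card * (p + q).choose q := by
          refine Finset.sum_le_sum fun u hu => ?_
          rw [Finset.mem_Ioo] at hu
          have h1 := card_Uq_le_card_shadowLev M p q
          exact (Nat.mul_le_mul_right _ h1).trans (hcum u hu.1 hu.2)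
      _ ≤ ∑ u ∈ Ioo q p, levelCount M u * (p + q).choose q := by
          refine Finset.sum_le_sum fun u _ => ?_
          exact Nat.mul_le_mul_right _ (card_shadowLev_le_levelCount M u _)
      _ = (∑ u ∈ Ioo q p, levelCount M u) * (p + q).choose p := by
          rw [Finset.sum_mul, Nat.choose_symm_add]
  exact_mod_cast key

/-- The one-step shadow inequalities at the levels `q … p − 2` give the cumulative shadow inequality. -/
theorem shadowCumulative_of_step (p q : ℕ)
    (hstep : ∀ u, q ≤ u → u + 2 ≤ p → (p + q - u) * (shadowLev M u (PerFlat.Uq M p q)).card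
      ≤ (u + 1) * (shadowLev M (u + 1) (PerFlat.Uq M p q)).card) : ShadowCumulative M p q :=
  fun u hqu hup => shadowLev_mul_choose_of_step M p q (PerFlat.Uq M p q) hstep u (by omega) (by omega)

end PercRepro.RankDist
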